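import Mathlib
import HarnessLib
import Summits.KontsevichZagierPeriods.KontsevichZagierPeriods.Theses.LinRedNormalForm
import Literature.NumberTheory.Transcendental.KZLogCalculusProofs
import Literature.NumberTheory.Transcendental.SemialgebraicLineDeriv
import Literature.NumberTheory.Transcendental.NashCubes

/-!
# `DihedralNormalForm`, line `torus-descent-sum-shadow`, stub `stub_torusDescent` — tools (Aux 1)

Support file for the stub `stub_torusDescent` of the crux `DihedralNormalForm`
(stmt-KontsevichZagierPeriods-3912, route `LinRedNormalForm`): the torus descent move of a cubical
atom `[□ᵏ⁺¹, q · xᵃ · ∏_{i ≤ j} (1 − x_{[i,j]})^{e i j}]` along a simple descent direction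
`lam ∈ {0, ±1}ᵏ⁺¹`. This file collects the dimension-free tools:

* the atom integrand `atomFun`, the total weight `wt`, the fibre edge `topP` (`max(0, max over the
  +1-coordinates)`, written as a real `iSup` as in the registered statement) and the base
  integrand `baseFun` of the descent;
* semialgebraicity of integer powers (`fun_zpow`), of inserted coordinates, of `atomFun` composed
  with coordinatewise-semialgebraic maps, and of `topP` (graph description, no Tarski–Seidenberg);
* the order-theoretic description of `topP` (`topP_eq_zero_or`, `le_topP`, `topP_le`);
* a null coordinate-diagonal `{x l = x p}` (`volume_setOf_apply_eq_apply`);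
* the fibrewise Newton–Leibniz inequality `‖F b − F a‖ₑ ≤ ∫⁻_{[a,b]} ‖F'‖ₑ` and the Tonelli
  bookkeeping lemma `integrableOn_of_lintegral_fibre_ge` (integrability of a fibre integral on the
  base from integrability on the band).

References: M. Kontsevich, D. Zagier, *Periods* (2001), §1.2 (rules (1)–(3)).
-/

noncomputable section

open MeasureTheory Set MvPolynomial
open scoped ENNReal
open Literature.ModelTheory.ExponentialFields (IsSemialgebraic)

namespace Summit.KontsevichZagierPeriods.DihedralNormalForm.TorusDescent

open Literature.NumberTheory.Transcendental
open Literature.ModelTheory.ExponentialFields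

/-! ### The objects of the descent -/

/-- The cubical atom integrand without its rational constant:
`xᵃ · ∏_{i ≤ j} (1 − x_i ⋯ x_j)^{e i j}`. -/
def atomFun {n : ℕ} (a : Fin n → ℕ) (e : Fin n → Fin n → ℤ) (x : Fin n → ℝ) : ℝ :=
  (∏ i : Fin n, x i ^ a i) * ∏ i : Fin n, ∏ j : Fin n,
    if i ≤ j then (1 - (∏ l : Fin n, if i ≤ l ∧ l ≤ j then x l else 1)) ^ e i j else 1

/-- The total weight `E = Σ_l lam l · (a l + 1)` of the direction `lam`. -/
def wt {n : ℕ} (a : Fin n → ℕ) (lam : Fin n → ℤ) : ℤ := ∑ l : Fin n, lam l * ((a l : ℤ) + 1)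

variable {k : ℕ}

/-- The lower edge `M_p(y) = max (0, max_{lam (p.succAbove j) = 1} y_j)` of the straightened band,
as a real indexed supremum over `Fin k` (`= 0` for `k = 0`). -/
def topP (lam : Fin (k + 1) → ℤ) (p : Fin (k + 1)) (y : Fin k → ℝ) : ℝ :=
  ⨆ j : Fin k, if lam (Fin.succAbove p j) = 1 then y j else (0:ℝ)

/-- The base integrand of the descent through the entry face `p`:
`(q/E) · g₀(insertNth p 1 y) · (M_p(y)^{-E} − 1)`. -/
def baseFun (q : ℚ) (a : Fin (k + 1) → ℕ) (e : Fin (k + 1) → Fin (k + 1) → ℤ)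
    (lam : Fin (k + 1) → ℤ) (p : Fin (k + 1)) (y : Fin k → ℝ) : ℝ :=
  ((q / ((wt a lam : ℤ) : ℚ) : ℚ) : ℝ) * atomFun a e (Fin.insertNth p (1:ℝ) y) *
    ((topP lam p y) ^ (-(wt a lam)) - 1)

/-! ### Semialgebraicity tools -/

section Semialgebraic

variable {d : ℕ} {W : Set (Fin d → ℝ)} {f : (Fin d → ℝ) → ℝ}

/-- Integer powers of a real `ℚ`-semialgebraic function are semialgebraic (Mathlib's junk value
`0⁻¹ = 0` included). [cite: BochnakCosteRoy1998, Prop. 2.2.6] -/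
theorem fun_zpow (hf : IsSemialgebraicFunOn ℚ W f) (n : ℤ) :
    IsSemialgebraicFunOn ℚ W fun x => f x ^ n := by
  cases n with
  | ofNat n => exact (hf.fun_pow n).congr fun x _ => by simp
  | negSucc n => exact ((hf.fun_pow (n + 1)).fun_inv).congr fun x _ => by simp [zpow_negSucc]

/-- The coordinates of `Fin.insertNth p (t x) (Y x)` are semialgebraic when `t` and the coordinates
of `Y` are. [folklore] -/
theorem isSemialgebraicFunOn_insertNth {t : (Fin d → ℝ) → ℝ} {Y : (Fin d → ℝ) → (Fin k → ℝ)}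
    (ht : IsSemialgebraicFunOn ℚ W t) (hY : ∀ j, IsSemialgebraicFunOn ℚ W fun x => Y x j)
    (p i : Fin (k + 1)) :
    IsSemialgebraicFunOn ℚ W fun x => (Fin.insertNth p (t x) (Y x) : Fin (k + 1) → ℝ) i := by
  rcases Fin.eq_self_or_eq_succAbove p i with rfl | ⟨j, rfl⟩
  · exact ht.congr fun x _ => by simp
  · exact (hY j).congr fun x _ => by simp

/-- `atomFun a e ∘ X` is semialgebraic when the coordinates of `X` are. [folklore] -/
theorem isSemialgebraicFunOn_atomFun_comp {n : ℕ} (hW : IsSemialgebraic ℚ W) (a : Fin n → ℕ)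
    (e : Fin n → Fin n → ℤ) {X : (Fin d → ℝ) → (Fin n → ℝ)}
    (hX : ∀ i, IsSemialgebraicFunOn ℚ W fun x => X x i) :
    IsSemialgebraicFunOn ℚ W fun x => atomFun a e (X x) := by
  unfold atomFun
  refine IsSemialgebraicFunOn.fun_mul ?_ ?_
  · exact IsSemialgebraicFunOn.fun_finsetProd _ hW fun i _ => (hX i).fun_pow (a i)
  · refine IsSemialgebraicFunOn.fun_finsetProd _ hW fun i _ => ?_
    refine IsSemialgebraicFunOn.fun_finsetProd _ hW fun j _ => ?_
    by_cases hij : i ≤ j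
    · simp only [if_pos hij]
      refine fun_zpow (IsSemialgebraicFunOn.fun_sub ?_ ?_) _
      · simpa using isSemialgebraicFunOn_const_ratCast hW 1
      · refine IsSemialgebraicFunOn.fun_finsetProd _ hW fun l _ => ?_
        by_cases hl : i ≤ l ∧ l ≤ j
        · simp only [if_pos hl]; exact hX l
        · simp only [if_neg hl]; simpa using isSemialgebraicFunOn_const_ratCast hW 1
    · simp only [if_neg hij]
      simpa using isSemialgebraicFunOn_const_ratCast hW 1

end Semialgebraic

/-! ### The fibre edge `topP` -/

section TopP

variable (lam : Fin (k + 1) → ℤ) (p : Fin (k + 1))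

/-- `topP` is one of its terms: either `0` or a `+1`-coordinate. [folklore] -/
theorem topP_eq_zero_or (y : Fin k → ℝ) :
    topP lam p y = 0 ∨ ∃ j, lam (Fin.succAbove p j) = 1 ∧ topP lam p y = y j := by
  unfold topP
  cases isEmpty_or_nonempty (Fin k) with
  | inl h => exact Or.inl (Real.iSup_of_isEmpty _)
  | inr h =>
    obtain ⟨j, hj⟩ := exists_eq_ciSup_of_finite
      (f := fun j : Fin k => if lam (Fin.succAbove p j) = 1 then y j else (0:ℝ))
    by_cases hP : lam (Fin.succAbove p j) = 1
    · exact Or.inr ⟨j, hP, by rw [← hj, if_pos hP]⟩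
    · exact Or.inl (by rw [← hj, if_neg hP])

/-- Every `+1`-coordinate is below `topP`. [folklore] -/
theorem le_topP (y : Fin k → ℝ) {j : Fin k} (hj : lam (Fin.succAbove p j) = 1) :
    y j ≤ topP lam p y := by
  unfold topP
  refine le_trans ?_ (le_ciSup (Set.finite_range _).bddAbove j)
  rw [if_pos hj]

/-- `topP y ≤ t` as soon as `0 ≤ t` bounds the `+1`-coordinates. [folklore] -/
theorem topP_le (y : Fin k → ℝ) {t : ℝ} (ht : 0 ≤ t)
    (h : ∀ j, lam (Fin.succAbove p j) = 1 → y j ≤ t) : topP lam p y ≤ t := by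
  unfold topP
  refine Real.iSup_le (fun j => ?_) ht
  split_ifs with hj
  · exact h j hj
  · exact ht

/-- `topP y ≥ 0` when the `+1`-coordinates are non-negative. [folklore] -/
theorem topP_nonneg (y : Fin k → ℝ) (h : ∀ j, lam (Fin.succAbove p j) = 1 → 0 ≤ y j) :
    0 ≤ topP lam p y := by
  rcases topP_eq_zero_or lam p y with h0 | ⟨j, hj, hjy⟩
  · rw [h0]
  · rw [hjy]; exact h j hj

/-- `topP y < t` iff `0 < t` and every `+1`-coordinate is `< t` (for non-negative
`+1`-coordinates). [folklore] -/
theorem topP_lt_iff (y : Fin k → ℝ) (h : ∀ j, lam (Fin.succAbove p j) = 1 → 0 ≤ y j) (t : ℝ) :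
    topP lam p y < t ↔ 0 < t ∧ ∀ j, lam (Fin.succAbove p j) = 1 → y j < t := by
  constructor
  · intro hlt
    exact ⟨(topP_nonneg lam p y h).trans_lt hlt, fun j hj => (le_topP lam p y hj).trans_lt hlt⟩
  · rintro ⟨ht, hall⟩
    rcases topP_eq_zero_or lam p y with h0 | ⟨j, hj, hjy⟩
    · rwa [h0]
    · rw [hjy]; exact hall j hj

/-- **`topP` is `ℚ`-semialgebraic** on every `ℚ`-semialgebraic set on which the `+1`-coordinates
are positive: its graph is cut out by `(w = 0 ∨ ∃ j ∈ P, w = y_j) ∧ (∀ j ∈ P, y_j ≤ w) ∧ 0 ≤ w`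
(polynomial conditions; no Tarski–Seidenberg). [cite: BochnakCosteRoy1998, §2.2] -/
theorem isSemialgebraicFunOn_topP {S : Set (Fin k → ℝ)} (hS : IsSemialgebraic ℚ S)
    (hpos : ∀ y ∈ S, ∀ j, lam (Fin.succAbove p j) = 1 → 0 < y j) :
    IsSemialgebraicFunOn ℚ S (topP lam p) := by
  classical
  set P : Finset (Fin k) := Finset.univ.filter fun j => lam (Fin.succAbove p j) = 1 with hP
  have hmemP : ∀ j, j ∈ P ↔ lam (Fin.succAbove p j) = 1 := fun j => by simp [hP]
  rw [isSemialgebraicFunOn_iff]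
  have hset : {z : Fin (k + 1) → ℝ | Fin.init z ∈ S ∧ z (Fin.last k) = topP lam p (Fin.init z)} =
      {z : Fin (k + 1) → ℝ | Fin.init z ∈ S} ∩
        (({z | z (Fin.last k) = 0} ∪ ⋃ j ∈ P, {z | z (Fin.last k) = z (Fin.castSucc j)}) ∩
          ((⋂ j ∈ P, {z | z (Fin.castSucc j) ≤ z (Fin.last k)}) ∩ {z | 0 ≤ z (Fin.last k)})) := by
    ext z
    simp only [mem_setOf_eq, mem_inter_iff, mem_union, mem_iUnion, mem_iInter, exists_prop, hmemP]
    refine ⟨fun ⟨hzS, hz⟩ => ⟨hzS, ?_, ?_, ?_⟩, fun ⟨hzS, h1, h2, h3⟩ => ⟨hzS, ?_⟩⟩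
    · rcases topP_eq_zero_or lam p (Fin.init z) with h0 | ⟨j, hj, hjy⟩
      · exact Or.inl (hz.trans h0)
      · exact Or.inr ⟨j, hj, hz.trans hjy⟩
    · intro j hj
      rw [hz]
      exact le_topP lam p (Fin.init z) hj
    · rw [hz]
      exact topP_nonneg lam p _ fun j hj => (hpos _ hzS j hj).le
    · have hle : topP lam p (Fin.init z) ≤ z (Fin.last k) :=
        topP_le lam p _ h3 fun j hj => h2 j hj
      refine le_antisymm ?_ hle
      rcases h1 with h0 | ⟨j, hj, hjz⟩
      · rw [h0]
        refine topP_nonneg lam p _ fun j hj => (hpos _ hzS j hj).le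
      · rw [hjz]
        exact le_topP lam p (Fin.init z) hj
  rw [hset]
  refine hS.setOf_init_mem.inter ((IsSemialgebraic.union ?_ ?_).inter (IsSemialgebraic.inter ?_ ?_))
  · simpa using isSemialgebraic_setOf_eval_eq_zero (k := ℚ) (R := ℝ)
      (X (Fin.last k) : MvPolynomial (Fin (k + 1)) ℚ)
  · refine IsSemialgebraic.biUnion P
      (fun j => {z : Fin (k + 1) → ℝ | z (Fin.last k) = z (Fin.castSucc j)}) fun j _ => ?_
    have h := isSemialgebraic_setOf_eval_eq_zero (k := ℚ) (R := ℝ)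
      (X (Fin.last k) - X (Fin.castSucc j) : MvPolynomial (Fin (k + 1)) ℚ)
    simpa [sub_eq_zero] using h
  · refine IsSemialgebraic.biInter P _ fun j _ => ?_
    simpa using isSemialgebraic_setOf_eval_le (k := ℚ) (R := ℝ)
      (X (Fin.castSucc j) : MvPolynomial (Fin (k + 1)) ℚ) (X (Fin.last k))
  · simpa using isSemialgebraic_setOf_eval_nonneg (k := ℚ) (R := ℝ)
      (X (Fin.last k) : MvPolynomial (Fin (k + 1)) ℚ)

end TopP

/-! ### Integer powers -/

/-- `∏_{j ∈ s} t^{n j} = t^{Σ_{j ∈ s} n j}` for `t ≠ 0`. [folklore] -/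
theorem prod_zpow_eq_zpow_sum {ι : Type*} (s : Finset ι) (n : ι → ℤ) {t : ℝ} (ht : t ≠ 0) :
    ∏ j ∈ s, t ^ n j = t ^ (∑ j ∈ s, n j) := by
  classical
  induction s using Finset.induction_on with
  | empty => simp
  | insert a s ha ih => rw [Finset.prod_insert ha, Finset.sum_insert ha, ih, zpow_add₀ ht]

/-- `t ↦ t ^ m` is continuous on `[u, v]` as soon as `0 < u` or `0 ≤ m`. [folklore] -/
theorem continuousOn_zpow_Icc (m : ℤ) {u v : ℝ} (h : 0 < u ∨ 0 ≤ m) :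
    ContinuousOn (fun t : ℝ => t ^ m) (Icc u v) := fun t ht =>
  (continuousAt_zpow₀ t m (h.imp (fun hu => (hu.trans_le ht.1).ne') id)).continuousWithinAt

/-! ### Measure-theoretic tools -/

/-- A coordinate diagonal `{x | x l = x p}` (`l ≠ p`) of `ℝⁿ` is Lebesgue-null (a proper linear
subspace). [folklore] -/
theorem volume_setOf_apply_eq_apply {n : ℕ} {l p : Fin n} (h : l ≠ p) :
    volume {x : Fin n → ℝ | x l = x p} = 0 := by
  set L : Submodule ℝ (Fin n → ℝ) :=
    LinearMap.ker ((LinearMap.proj (R := ℝ) (φ := fun _ : Fin n => ℝ) l) -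
      LinearMap.proj (R := ℝ) (φ := fun _ : Fin n => ℝ) p) with hL
  have hLne : L ≠ ⊤ := by
    intro htop
    have hmem : (Pi.single l (1:ℝ) : Fin n → ℝ) ∈ L := by rw [htop]; exact Submodule.mem_top
    rw [hL, LinearMap.mem_ker] at hmem
    simp [Pi.single_eq_of_ne' h] at hmem
  have hset : {x : Fin n → ℝ | x l = x p} = (L : Set (Fin n → ℝ)) := by
    ext x
    simp [hL, sub_eq_zero]
  rw [hset]
  exact Measure.addHaar_submodule volume L hLne

/-- **Fibrewise Newton–Leibniz inequality**: if `F` is continuous on `[a, b]` with derivative `f`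
on `(a, b)` and `f` is continuous on `[a, b]`, then `‖F b − F a‖ₑ ≤ ∫⁻_{[a,b]} ‖f‖ₑ`. [folklore] -/
theorem enorm_sub_le_lintegral_Icc {f F : ℝ → ℝ} {a b : ℝ} (hab : a ≤ b)
    (hcont : ContinuousOn F (Icc a b)) (hder : ∀ t ∈ Ioo a b, HasDerivAt F (f t) t)
    (hf : ContinuousOn f (Icc a b)) : ‖F b - F a‖ₑ ≤ ∫⁻ t in Icc a b, ‖f t‖ₑ := by
  rw [← intervalIntegral.integral_eq_sub_of_hasDerivAt_of_le hab hcont hder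
    (hf.intervalIntegrable_of_Icc hab), intervalIntegral.integral_of_le hab]
  exact (enorm_integral_le_lintegral_enorm _).trans (lintegral_mono_set Ioc_subset_Icc_self)

/-- **Tonelli bookkeeping.** Integrability of a fibre integral `K` on the base `S` from that of
`W` on the band `B = {(x,t) | x ∈ S, a x ≤ t ≤ b x}`, given the fibrewise bound
`‖K x‖ₑ ≤ ∫⁻_{[a x, b x]} ‖W (x,t)‖ₑ` (`MeasurableEquiv.piFinSuccAbove`, `lintegral_prod`).
[folklore] -/
-- adapted from Summits/KontsevichZagierPeriods/KontsevichZagierPeriods/Cruxes/UnfoldedLogStokes/Disproof.lean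
theorem integrableOn_of_lintegral_fibre_ge {m : ℕ} {S : Set (Fin m → ℝ)} (hS : MeasurableSet S)
    {a b : (Fin m → ℝ) → ℝ} {B : Set (Fin (m + 1) → ℝ)} (hB : MeasurableSet B)
    (hmem : ∀ (x : Fin m → ℝ) (t : ℝ),
      (Fin.snoc x t : Fin (m + 1) → ℝ) ∈ B ↔ x ∈ S ∧ t ∈ Icc (a x) (b x))
    {W : (Fin (m + 1) → ℝ) → ℝ} (hW : IntegrableOn W B)
    {K : (Fin m → ℝ) → ℝ} (hK : AEStronglyMeasurable K (volume.restrict S))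
    (hfib : ∀ x ∈ S, ‖K x‖ₑ ≤ ∫⁻ t in Icc (a x) (b x), ‖W (Fin.snoc x t)‖ₑ) :
    IntegrableOn K S := by
  refine ⟨hK, ?_⟩
  have hBW : Integrable (B.indicator W) := (integrable_indicator_iff hB).2 hW
  set e : (Fin (m + 1) → ℝ) ≃ᵐ ℝ × (Fin m → ℝ) :=
    MeasurableEquiv.piFinSuccAbove (fun _ => ℝ) (Fin.last m) with he_def
  have he : MeasurePreserving e volume volume :=
    volume_preserving_piFinSuccAbove (fun _ => ℝ) (Fin.last m)
  have he_symm : ∀ p : ℝ × (Fin m → ℝ), e.symm p = Fin.snoc p.2 p.1 := fun p => by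
    simp [he_def, MeasurableEquiv.piFinSuccAbove, Fin.snocEquiv]
  have hfib_in : ∀ x ∈ S, ∀ t, ‖B.indicator W (Fin.snoc x t)‖ₑ =
      (Icc (a x) (b x)).indicator (fun t => ‖W (Fin.snoc x t)‖ₑ) t := by
    intro x hx t
    by_cases ht : t ∈ Icc (a x) (b x)
    · rw [indicator_of_mem ht, indicator_of_mem ((hmem x t).2 ⟨hx, ht⟩)]
    · rw [indicator_of_notMem ht, indicator_of_notMem (fun h => ht ((hmem x t).1 h).2),
        enorm_zero]
  have hmeas : AEMeasurable (fun p : ℝ × (Fin m → ℝ) => ‖B.indicator W (e.symm p)‖ₑ)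
      ((volume : Measure ℝ).prod (volume : Measure (Fin m → ℝ))) := by
    rw [← Measure.volume_eq_prod]
    exact (hBW.aestronglyMeasurable.comp_quasiMeasurePreserving
      (he.symm e).quasiMeasurePreserving).enorm
  unfold HasFiniteIntegral
  calc ∫⁻ x in S, ‖K x‖ₑ
      ≤ ∫⁻ x in S, ∫⁻ t in Icc (a x) (b x), ‖W (Fin.snoc x t)‖ₑ :=
        lintegral_mono_ae ((ae_restrict_mem hS).mono fun x hx => hfib x hx)
    _ = ∫⁻ x, S.indicator (fun x => ∫⁻ t in Icc (a x) (b x), ‖W (Fin.snoc x t)‖ₑ) x :=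
        (lintegral_indicator hS _).symm
    _ = ∫⁻ x, ∫⁻ t, ‖B.indicator W (e.symm (t, x))‖ₑ := by
        refine lintegral_congr fun x => ?_
        simp_rw [he_symm]
        by_cases hx : x ∈ S
        · rw [indicator_of_mem hx, ← lintegral_indicator measurableSet_Icc]
          simp_rw [hfib_in x hx]
        · rw [indicator_of_notMem hx]
          have h0 : ∀ t, ‖B.indicator W (Fin.snoc x t)‖ₑ = 0 := fun t => by
            rw [indicator_of_notMem (fun h => hx ((hmem x t).1 h).1), enorm_zero]
          simp_rw [h0, lintegral_zero]
    _ = ∫⁻ p, ‖B.indicator W (e.symm p)‖ₑ ∂((volume : Measure ℝ).prod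
          (volume : Measure (Fin m → ℝ))) := (lintegral_prod_symm _ hmeas).symm
    _ = ∫⁻ p, ‖B.indicator W (e.symm p)‖ₑ := by rw [Measure.volume_eq_prod]
    _ = ∫⁻ z, ‖B.indicator W z‖ₑ :=
        (he.symm e).lintegral_comp_emb e.symm.measurableEmbedding (fun z => ‖B.indicator W z‖ₑ)
    _ < ⊤ := hBW.2


/-- Registered sub-goal `stub_torusDescentAux1` of `stub_torusDescent` (the null coordinate
diagonals used by the dissection of the cube by the entry face). [folklore] -/
theorem stub_torusDescentAux1 : ∀ (n : ℕ) (l p : Fin n), l ≠ p → MeasureTheory.volume {x : Fin n → ℝ | x l = x p} = 0 :=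
  fun _ _ _ h => volume_setOf_apply_eq_apply h

end Summit.KontsevichZagierPeriods.DihedralNormalForm.TorusDescent
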